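import Summits.ABC.ABC.Theorems.DefiniteXiDefiniteRTControlPrimeOfTakahashi
import Literature.NumberTheory.EllipticCurves.TakahashiDegreeFormulaCoprimeProofs
import HarnessLib

/-!
# STUB-IDEAS companion — `stub_takahashi` · ideator k1 · generation 23 (FAMILY 1: recognise & import)

Crux `stmt-ABC-11338` (`Summit.ABC.ABC.Theses.DefiniteXi.DefiniteRTControlPrime`); registered stub
`theorem stub_takahashi : takahashi2001_thm_2_3_of_coprime` (the reviewed, cite-tagged NAMED FACT
`Literature.NumberTheory.EllipticCurves.takahashi2001_thm_2_3_of_coprime`, `TakahashiDegreeFormula.lean:265`).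

HEAD sanity (no new mathematics, no `sorry`) of every door the gen-23 sheet
`STUB-IDEAS-stub_takahashi-1.md` names:

* `stub_of_fact` — Plan A door: inside a skeleton the stub closes only by the fact itself;
* `crux_of_stub` — the ONE-stub composition BY NAME over the landed
  `Summit.ABC.ABC.Theorems.DefiniteRTControlPrime.definiteRTControlPrime_of_takahashi`;
* `touchpoint` — the only instance of the fact the landed closer consumes (one-sided
  `δ ≤ ξ · ord_r Δ_min` at a conductor-minimal datum of type `(M, r)`, `gcd(M, r) = 1`);
* the import doors `takahashi2001_thm_2_3_of_coprime_of_exists_setup` (ONE Brandt setup per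
  `(W, M, r, P)` suffices) and `takahashi2001_thm_2_3_of_coprime_of_brandtDictionary_one'` (rank one +
  geometric Brandt dictionary ⇒ fact) resolve at HEAD (two `example`s).

[cite: Takahashi2001, Thm. 2.3 (p. 79)]
-/

set_option linter.dupNamespace false

namespace Summit.ABC.ABC.Cruxes.DefiniteRTControlPrime.StubIdeas1G23

open Literature.NumberTheory.EllipticCurves Literature.NumberTheory.EllipticCurves.ModularForms
open Literature.NumberTheory.Automorphic

/-- L0 (Plan A door, XS): the stub IS the named fact. -/
theorem stub_of_fact (h : takahashi2001_thm_2_3_of_coprime) : takahashi2001_thm_2_3_of_coprime := h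

/-- L1 (XS, kernel-checked): the crux BY NAME from the stub statement, via the landed closer. -/
theorem crux_of_stub (h : takahashi2001_thm_2_3_of_coprime) :
    Summit.ABC.ABC.Theses.DefiniteXi.DefiniteRTControlPrime :=
  Summit.ABC.ABC.Theorems.DefiniteRTControlPrime.definiteRTControlPrime_of_takahashi h

/-- L5 (XS): the consumed touchpoint — the one-sided corollary at a conductor-minimal datum. -/
theorem touchpoint (h : takahashi2001_thm_2_3_of_coprime) (W : WeierstrassCurve ℚ) [W.IsElliptic]
    (M r : ℕ) [NeZero (M * r)] (hr : r.Prime) (hcop : M.Coprime r)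
    (hN : W.conductorNorm ℤ = M * r) (P : ModularParametrizationData W (M * r))
    (hmin : ∀ (W' : WeierstrassCurve ℚ) [W'.IsElliptic], W'.conductorNorm ℤ = M * r →
      ∀ P' : ModularParametrizationData W' (M * r),
        P'.f = P.f → P.modularDegree ≤ P'.modularDegree) :
    P.modularDegree ≤
      brandtXi M r (fun n => W.LFunction n) * (W.minimalDiscriminantNorm ℤ).factorization r :=
  takahashi2001_thm_2_3_of_coprime.modularDegree_le_brandtXi_mul h W M r hr hcop hN P hmin

/-- L2 door (tree, PROVED): the fact from its conclusion in ONE setup per `(W, M, r, P)`. -/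
example := @takahashi2001_thm_2_3_of_coprime_of_exists_setup

/-- L3 door (tree, PROVED): the fact from multiplicity one + the geometric Brandt dictionary. -/
example := @takahashi2001_thm_2_3_of_coprime_of_brandtDictionary_one'

end Summit.ABC.ABC.Cruxes.DefiniteRTControlPrime.StubIdeas1G23
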